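import Summits.QuantumAdvantage.QuantumAdvantage.Theses.DWalkThree
import Summits.QuantumAdvantage.AdviceFreeQNC0.UnreadGap
import HarnessLib

/-!
# Route DWalkThree, support `RingUnreadGap3` (stmt-QuantumAdvantage-22506): E2, the unread-gap bound — PROVED

Ring-language closer over the normal-form theorem `Summit.QuantumAdvantage.AdviceFreeQNC0.DWalk.unreadGap_normalForm`
(`AdviceFreeQNC0/UnreadGap.lean`, cell qa-qnc0): a strategy `f` that never deviates from the canonical guess `tGuess` at
the output positions `a ≤ k ≤ a + w` on odd inputs and whose deviation pattern does not depend on the window bits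
`a ≤ j < a + w` wins the ring game on at most `(2/3)·2^{N-1} + (1/3)·2^{N+3-w}` odd inputs (indeed `… + (1/3)·2^{N+2-w}`).
Dictionary: ringing set `R x = {k : f x k ≠ tGuess x k}`, trace form of the relation on the odd class (`traceForm`,
`dk3_ne_one_iff`); `w ≤ 2` is trivial.

* `dWalkThree_ringUnreadGap3 : RingUnreadGap3`.

WHAT THIS IS NOT: `R0` (`RingFixedBellsSharp3`) and the dense residual stay OPEN; rung F-Q2-odd3 (`p = 3`) support only;
separation NOT moved.
-/

set_option linter.dupNamespace false

namespace Summit.QuantumAdvantage.QuantumAdvantage.Theorems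

open Classical
open Finset
open Summit.QuantumAdvantage.AdviceFreeQNC0 Summit.QuantumAdvantage.AdviceFreeQNC0.DWalk
open Literature.Computability.QuantumComplexity Literature.Computability.QuantumComplexity.RingHLF
open Literature.Computability.MetaComplexity Literature.Computability.MetaComplexity.Smolensky

/-- **Support `RingUnreadGap3` (E2, the unread-gap bound) — PROVED.** -/
theorem dWalkThree_ringUnreadGap3 : Summit.QuantumAdvantage.QuantumAdvantage.Theses.DWalkThree.RingUnreadGap3 := by
  unfold Summit.QuantumAdvantage.QuantumAdvantage.Theses.DWalkThree.RingUnreadGap3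
  intro N a w hN f hfix hind
  obtain ⟨n, rfl⟩ : ∃ n, N = n + 1 := ⟨N - 1, by omega⟩
  have hpow1 : 2 * 2 ^ (n + 1 - 1) = 2 ^ (n + 1) := by rw [Nat.add_sub_cancel, pow_succ]; ring
  by_cases hw : w ≤ 2
  · -- trivial: at most `2^N` patterns
    have hle : (univ.filter fun x : Fin (n + 1) → Bool => OddZeros x ∧ Rel x (f x)).card ≤ 2 ^ (n + 1) := by
      refine le_trans (Finset.card_le_univ _) (le_of_eq ?_)
      rw [Fintype.card_fun, Fintype.card_bool, Fintype.card_fin]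
    have h2 : 2 ^ (n + 1 + 1) ≤ 2 ^ (n + 1 + 3 - w) := Nat.pow_le_pow_right (by norm_num) (by omega)
    have h3 : 2 ^ (n + 1 + 1) = 2 * 2 ^ (n + 1) := by rw [pow_succ]; ring
    omega
  -- the normal form
  have hL1 : 1 ≤ w := by omega
  have haW : a + (0 + 1) * w ≤ n := by omega
  set R : (Fin (n + 1) → Bool) → Finset (Fin (n + 1)) := fun x => univ.filter fun k : Fin (n + 1) => f x k ≠ tGuess x k
    with hR
  have hRout : ∀ x : Fin (n + 1) → Bool, (univ.filter fun j : Fin (n + 1) => x j = false).card % 2 = 1 →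
      ∀ k ∈ R x, k.val ≤ a ∨ a + (0 + 1) * w ≤ k.val := by
    intro x hodd k hk
    rw [hR, mem_filter] at hk
    by_contra hcon
    exact hk.2 (hfix x hodd k (by omega) (by omega))
  have hRind : ∀ x x' : Fin (n + 1) → Bool,
      (∀ j : Fin (n + 1), ¬ (a ≤ j.val ∧ j.val < a + (0 + 1) * w) → x j = x' j) → R x = R x' := by
    intro x x' hagree
    have h := hind x x' fun j hj => hagree j (by omega)
    ext k
    simp only [hR, mem_filter, mem_univ, true_and]
    exact not_congr (h k)
  have core := unreadGap_normalForm hL1 haW R hRout hRind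
  -- identify the solved odd patterns with the winning odd patterns of the normal form
  have hxor : ∀ b c : Bool, (xor b c = true) ↔ b ≠ c := by decide
  have hset : (univ.filter fun x : Fin (n + 1) → Bool => OddZeros x ∧ Rel x (f x)) =
      univ.filter fun x : Fin (n + 1) → Bool =>
        (univ.filter fun j : Fin (n + 1) => x j = false).card % 2 = 1 ∧
          ((R x).filter fun k => Dk3 x k.val ≠ 1).card % 2 = 1 := by
    ext x
    simp only [mem_filter, mem_univ, true_and]
    have key : ∀ hodd : (univ.filter fun j : Fin (n + 1) => x j = false).card % 2 = 1,
        (Rel x (f x) ↔ ((R x).filter fun k => Dk3 x k.val ≠ 1).card % 2 = 1) := by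
      intro hodd
      rw [traceForm (by omega) x hodd]
      have heq : (univ.filter fun k : Fin (n + 1) => xor (f x k) (tGuess x k) = true ∧
            (k.val + (n + 1) + Wk x k.val + Wk x (n + 1 - 1)) % 3 ≠ 2) =
          (R x).filter fun k => Dk3 x k.val ≠ 1 := by
        ext k
        simp only [hR, mem_filter, mem_univ, true_and, hxor, dk3_ne_one_iff]
      rw [heq]
    constructor
    · rintro ⟨hodd, hrel⟩; exact ⟨hodd, (key hodd).1 hrel⟩
    · rintro ⟨hodd, hwin⟩; exact ⟨hodd, (key hodd).2 hwin⟩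
  rw [hset]
  have h2 : 2 ^ (n + 3 - w) ≤ 2 ^ (n + 1 + 3 - w) := Nat.pow_le_pow_right (by norm_num) (by omega)
  omega

end Summit.QuantumAdvantage.QuantumAdvantage.Theorems
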